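import Literature.Geometry.Lorentzian.TeukolskyRealAxisModeStability
import Mathlib.Analysis.SpecialFunctions.Pow.Deriv
import HarnessLib

/-!
# The scalar radial Teukolsky equation of EXTREMAL Kerr at the superradiant threshold `ω = m/(2M)`:
# a regular singular point at `r = M` with exponents `−½ ± iδ`, `δ² = 7m²/4 − ¼ − λ`

This is the FAR FACE of the near-extremal threshold layer (Teukolsky–Press 1974 matched asymptotics;
Gralla–Zimmerman–Zimmerman 2016 §2.2): letting `a → M`, `ω → mΩ_H` at fixed `r` in the scalar (`s = 0`)
radial Teukolsky equation `ΔR″ + 2(r − M)R′ + (K²/Δ − λ − a²ω² + 2amω)R = 0`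
(`Kerr.IsRadialTeukolskySolution`, Teixeira da Costa's `λ`) gives, since `Δ = (r − M)²` and
`K = ω(r² + a²) − am = (m/2M)(r − M)(r + M)` at `(a, ω) = (M, m/2M)`,

  `(r − M)²R″ + 2(r − M)R′ + (m²(r + M)²/(4M²) + 3m²/4 − λ)R = 0`   on `r > M`,        (∗)

(`isRadialTeukolskySolution_extremal_threshold_iff`): the double pole of `K²/Δ²` has cancelled, `r = M` is a
REGULAR singular point, and the coefficient there is `7m²/4 − λ` (`coeff_extremal_threshold_at_horizon`), so
the indicial equation is `ρ² + ρ + 7m²/4 − λ = 0`, `ρ = −½ ± iδ` with `δ² = 7m²/4 − ¼ − λ` — GZZ's `δ²`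
(their eq. (10), `s = 0`, `ₛA_{ℓm} = λ`). The model EULER equation `y²f″ + 2yf′ + qf = 0` (`y = r − M > 0`) is solved
exactly by `f = y^c` for every root `c² + c + q = 0` (`euler_cpow_solution`), in particular by
`y^{−½ ± iδ}` for `q = δ² + ¼` (`euler_face_exponents`, `euler_face_pair`) — the basis to which the throat's `x^{−½±iδ}`
matches (`NearExtremalThroatHypergeometric.lean`) and from which the Teukolsky–Press far-zone amplitudes are
read off (`TeukolskyPressNearExtremalAmplitudes.lean`). Pure calculus/algebra; nothing asymptotic is claimed.

References: Teukolsky–Press, ApJ 193 (1974) 443, §III [TeukolskyPress1974]; Gralla–Zimmerman–Zimmerman,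
arXiv:1608.04739, §2.2 eqs. (9)–(10) [GrallaZimmermanZimmerman2016]; Teixeira da Costa arXiv:1910.02854
§2.2.3 (the radial ODE) [Costa2019].
-/

noncomputable section

open Complex

namespace Literature.Geometry.Lorentzian.Kerr.TeukolskyPress

/-- At `a = M` the outer horizon radius is `r₊ = M`. [folklore] -/
theorem rPlus_extremal (M : ℝ) : rPlus M M = M := by
  simp [rPlus]

/-- At `a = M`, `Δ(r) = (r − M)²`. [folklore] -/
theorem delta_extremal (M r : ℝ) : delta M M r = (r - M) ^ 2 := by
  unfold delta; ring

/-- At the threshold frequency `ω = m/(2M)` of extremal Kerr, `K(r) = (m/2M)(r − M)(r + M)` (`M ≠ 0`).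
[folklore] -/
theorem radialK_extremal_threshold {M : ℝ} (hM : M ≠ 0) (m r : ℝ) :
    radialK M (m / (2 * M)) m r = m / (2 * M) * (r - M) * (r + M) := by
  unfold radialK
  field_simp
  ring

/-- The coefficient of (∗): `K²/Δ − λ − a²ω² + 2amω = m²(r+M)²/(4M²) + 3m²/4 − λ` at `(a, ω) = (M, m/2M)`,
`r ≠ M`, `M ≠ 0`. [cite: GrallaZimmermanZimmerman2016, Section 2.2 eqs. (9)-(10)] -/
theorem coeff_extremal_threshold {M : ℝ} (hM : M ≠ 0) (m lam : ℝ) {r : ℝ} (hr : r ≠ M) :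
    radialK M (m / (2 * M)) m r ^ 2 / delta M M r - lam - M ^ 2 * (m / (2 * M)) ^ 2 +
        2 * M * m * (m / (2 * M)) =
      m ^ 2 * (r + M) ^ 2 / (4 * M ^ 2) + 3 * m ^ 2 / 4 - lam := by
  rw [radialK_extremal_threshold hM, delta_extremal]
  have hrM : r - M ≠ 0 := sub_ne_zero.2 hr
  field_simp
  ring

/-- At `r = M` the coefficient of (∗) equals `7m²/4 − λ`; with `δ² = 7m²/4 − ¼ − λ` this is `δ² + ¼`, so the
indicial roots of (∗) are `−½ ± iδ` (GZZ eq. (10), `s = 0`). [cite: GrallaZimmermanZimmerman2016, Section 2.2 eq. (10)] -/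
theorem coeff_extremal_threshold_at_horizon {M : ℝ} (hM : M ≠ 0) (m lam : ℝ) :
    m ^ 2 * (M + M) ^ 2 / (4 * M ^ 2) + 3 * m ^ 2 / 4 - lam = 7 * m ^ 2 / 4 - lam := by
  field_simp
  ring

/-- **The extremal-threshold radial equation, explicitly.** For `M > 0`, `s = 0`, `a = M`, `ω = m/(2M)`:
`R` is a classical radial Teukolsky solution (`Kerr.IsRadialTeukolskySolution`, TdC `λ`) iff it is twice
differentiable on `r > M` and satisfies `(r−M)²R″ + 2(r−M)R′ + (m²(r+M)²/(4M²) + 3m²/4 − λ)R = 0` there —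
a second-order ODE with a regular singular point at `r = M`.
[cite: GrallaZimmermanZimmerman2016, Section 2.2 eqs. (9)-(10)] -/
theorem isRadialTeukolskySolution_extremal_threshold_iff {M : ℝ} (hM : 0 < M) (m lam : ℝ) (R : ℝ → ℂ) :
    IsRadialTeukolskySolution M M 0 (m / (2 * M)) m lam R ↔
      ∃ R' R'' : ℝ → ℂ, ∀ r : ℝ, M < r →
        HasDerivAt R (R' r) r ∧ HasDerivAt R' (R'' r) r ∧
          (((r - M) ^ 2 : ℝ) : ℂ) * R'' r + 2 * ((r - M : ℝ) : ℂ) * R' r +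
            ((m ^ 2 * (r + M) ^ 2 / (4 * M ^ 2) + 3 * m ^ 2 / 4 - lam : ℝ) : ℂ) * R r = 0 := by
  -- the two left-hand sides agree as functions of (R r, R' r, R'' r)
  have key : ∀ r : ℝ, M < r → ∀ x y z : ℂ,
      (delta M M r : ℂ) * z + 2 * (((0 : ℝ) + 1 : ℝ) : ℂ) * ((r - M : ℝ) : ℂ) * y +
        ((((radialK M (m / (2 * M)) m r ^ 2 : ℝ) : ℂ) -
              2 * I * ((0 : ℝ) : ℂ) * ((r - M : ℝ) : ℂ) * (radialK M (m / (2 * M)) m r : ℂ)) /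
              (delta M M r : ℂ) +
            4 * I * ((0 : ℝ) : ℂ) * ((m / (2 * M) : ℝ) : ℂ) * (r : ℂ) - (lam : ℂ) -
            ((M ^ 2 * (m / (2 * M)) ^ 2 : ℝ) : ℂ) + ((2 * M * m * (m / (2 * M)) : ℝ) : ℂ)) * x =
      (((r - M) ^ 2 : ℝ) : ℂ) * z + 2 * ((r - M : ℝ) : ℂ) * y +
        ((m ^ 2 * (r + M) ^ 2 / (4 * M ^ 2) + 3 * m ^ 2 / 4 - lam : ℝ) : ℂ) * x := by
    intro r hr x y z
    have hrM : r ≠ M := ne_of_gt hr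
    have hc := coeff_extremal_threshold hM.ne' m lam hrM
    have hδ : (delta M M r : ℂ) ≠ 0 := by
      rw [delta_extremal]; exact_mod_cast pow_ne_zero 2 (sub_ne_zero.2 hrM)
    have hcoef : (((radialK M (m / (2 * M)) m r ^ 2 : ℝ) : ℂ) -
          2 * I * ((0 : ℝ) : ℂ) * ((r - M : ℝ) : ℂ) * (radialK M (m / (2 * M)) m r : ℂ)) /
          (delta M M r : ℂ) +
        4 * I * ((0 : ℝ) : ℂ) * ((m / (2 * M) : ℝ) : ℂ) * (r : ℂ) - (lam : ℂ) -
        ((M ^ 2 * (m / (2 * M)) ^ 2 : ℝ) : ℂ) + ((2 * M * m * (m / (2 * M)) : ℝ) : ℂ) =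
        ((m ^ 2 * (r + M) ^ 2 / (4 * M ^ 2) + 3 * m ^ 2 / 4 - lam : ℝ) : ℂ) := by
      rw [← hc]
      push_cast
      ring
    rw [hcoef, delta_extremal]
    push_cast
    ring
  unfold IsRadialTeukolskySolution
  rw [rPlus_extremal]
  constructor
  · rintro ⟨R', R'', h⟩
    refine ⟨R', R'', fun r hr => ?_⟩
    obtain ⟨h1, h2, h3⟩ := h r hr
    refine ⟨h1, h2, ?_⟩
    rw [← key r hr (R r) (R' r) (R'' r)]
    exact h3
  · rintro ⟨R', R'', h⟩
    refine ⟨R', R'', fun r hr => ?_⟩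
    obtain ⟨h1, h2, h3⟩ := h r hr
    refine ⟨h1, h2, ?_⟩
    rw [key r hr (R r) (R' r) (R'' r)]
    exact h3

/-! ### The Euler face: exact power solutions `y^c` (`y = r − M > 0`), `c² + c + q = 0` -/

/-- **Power solutions of the Euler face** (in the variable `y = r − M > 0`). If `c² + c + q = 0` then
`f(y) = y^c` (principal complex power of the positive real `y`) satisfies `y²f″ + 2yf′ + qf = 0`, with
`f′ = c·y^c/y`, `f″ = c(c−1)·y^c/y²`. [folklore] -/
theorem euler_cpow_solution {c q : ℂ} (hc : c ^ 2 + c + q = 0) {y : ℝ} (hy : 0 < y) :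
    HasDerivAt (fun t : ℝ => (t : ℂ) ^ c) (c * (y : ℂ) ^ c / y) y ∧
    HasDerivAt (fun t : ℝ => c * (t : ℂ) ^ c / t) (c * (c - 1) * (y : ℂ) ^ c / (y : ℂ) ^ 2) y ∧
    (y : ℂ) ^ 2 * (c * (c - 1) * (y : ℂ) ^ c / (y : ℂ) ^ 2) + 2 * (y : ℂ) * (c * (y : ℂ) ^ c / y) +
      q * (y : ℂ) ^ c = 0 := by
  have hz : (y : ℂ) ≠ 0 := by exact_mod_cast hy.ne'
  have hslit : (y : ℂ) ∈ Complex.slitPlane := Complex.ofReal_mem_slitPlane.2 hy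
  -- d/dt (t:ℂ)^w = w t^w / t for every w
  have hpow : ∀ w : ℂ, HasDerivAt (fun t : ℝ => (t : ℂ) ^ w) (w * (y : ℂ) ^ w / y) y := by
    intro w
    have h := (Complex.hasStrictDerivAt_cpow_const (c := w) hslit).hasDerivAt.comp_ofReal
    have e : w * (y : ℂ) ^ (w - 1) = w * (y : ℂ) ^ w / y := by
      rw [Complex.cpow_sub _ _ hz, Complex.cpow_one]; ring
    exact h.congr_deriv e
  refine ⟨hpow c, ?_, ?_⟩
  · have hinv : HasDerivAt (fun t : ℝ => ((t : ℂ))⁻¹) (-((y : ℂ) ^ 2)⁻¹) y :=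
      (hasDerivAt_inv hz).comp_ofReal
    have hprod := ((hpow c).const_mul c).mul hinv
    have e : c * (c * (y : ℂ) ^ c / y) * ((y : ℂ))⁻¹ + c * (y : ℂ) ^ c * -((y : ℂ) ^ 2)⁻¹ =
        c * (c - 1) * (y : ℂ) ^ c / (y : ℂ) ^ 2 := by
      field_simp
      ring
    have hfun : (fun t : ℝ => c * (t : ℂ) ^ c / t) = fun t : ℝ => c * (t : ℂ) ^ c * ((t : ℂ))⁻¹ := by
      funext t; ring
    rw [hfun]
    exact hprod.congr_deriv e
  · field_simp
    linear_combination ((y : ℂ) ^ c) * hc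

/-- **The Euler-face pair `y^{−½ ± iδ}`.** For every complex `δ` the exponents `c± = −½ ± iδ` satisfy
`c² + c + (δ² + ¼) = 0`, so `y^{−½±iδ}` solve `y²f″ + 2yf′ + (δ² + ¼)f = 0` on `y > 0` (`euler_cpow_solution`);
with `y = r − M` and `δ² = 7m²/4 − ¼ − λ` this is the leading behaviour at `r → M⁺` of the extremal threshold
solutions (GZZ §2.2: principal sectors `δ² > 0`, oscillatory `y^{−½}e^{±iδ log y}`; supplementary `δ² < 0`,
real powers), and with `y = x` the Euler stretch of the throat equation. [cite: GrallaZimmermanZimmerman2016, Section 2.2 eq. (10)] -/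
theorem euler_face_exponents (δ : ℂ) :
    (-(1 / 2 : ℂ) + δ * I) ^ 2 + (-(1 / 2 : ℂ) + δ * I) + (δ ^ 2 + 1 / 4) = 0 ∧
    (-(1 / 2 : ℂ) - δ * I) ^ 2 + (-(1 / 2 : ℂ) - δ * I) + (δ ^ 2 + 1 / 4) = 0 := by
  constructor <;> linear_combination (δ ^ 2) * Complex.I_sq

/-- The two Euler-face solutions `y^{−½+iδ}`, `y^{−½−iδ}` of `y²f″ + 2yf′ + (δ² + ¼)f = 0` on `y > 0`
(`euler_cpow_solution` at the two roots of `euler_face_exponents`). [cite: GrallaZimmermanZimmerman2016, Section 2.2 eq. (10)] -/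
theorem euler_face_pair (δ : ℂ) {y : ℝ} (hy : 0 < y) :
    (HasDerivAt (fun t : ℝ => (t : ℂ) ^ (-(1 / 2 : ℂ) + δ * I))
        ((-(1 / 2 : ℂ) + δ * I) * (y : ℂ) ^ (-(1 / 2 : ℂ) + δ * I) / y) y ∧
      (y : ℂ) ^ 2 * ((-(1 / 2 : ℂ) + δ * I) * ((-(1 / 2 : ℂ) + δ * I) - 1) *
          (y : ℂ) ^ (-(1 / 2 : ℂ) + δ * I) / (y : ℂ) ^ 2) +
        2 * (y : ℂ) * ((-(1 / 2 : ℂ) + δ * I) * (y : ℂ) ^ (-(1 / 2 : ℂ) + δ * I) / y) +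
        (δ ^ 2 + 1 / 4) * (y : ℂ) ^ (-(1 / 2 : ℂ) + δ * I) = 0) ∧
    (HasDerivAt (fun t : ℝ => (t : ℂ) ^ (-(1 / 2 : ℂ) - δ * I))
        ((-(1 / 2 : ℂ) - δ * I) * (y : ℂ) ^ (-(1 / 2 : ℂ) - δ * I) / y) y ∧
      (y : ℂ) ^ 2 * ((-(1 / 2 : ℂ) - δ * I) * ((-(1 / 2 : ℂ) - δ * I) - 1) *
          (y : ℂ) ^ (-(1 / 2 : ℂ) - δ * I) / (y : ℂ) ^ 2) +
        2 * (y : ℂ) * ((-(1 / 2 : ℂ) - δ * I) * (y : ℂ) ^ (-(1 / 2 : ℂ) - δ * I) / y) +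
        (δ ^ 2 + 1 / 4) * (y : ℂ) ^ (-(1 / 2 : ℂ) - δ * I) = 0) := by
  obtain ⟨hp, hm⟩ := euler_face_exponents δ
  obtain ⟨a1, -, a3⟩ := euler_cpow_solution hp hy
  obtain ⟨b1, -, b3⟩ := euler_cpow_solution hm hy
  exact ⟨⟨a1, a3⟩, ⟨b1, b3⟩⟩

end Literature.Geometry.Lorentzian.Kerr.TeukolskyPress

end
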